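import Summits.BirchSwinnertonDyer.BirchSwinnertonDyer.Theorems.CMKolyvaginAtInertTwoCebotarevLeafAtTwoPow
import Literature.NumberTheory.EllipticCurves.BSDRankZeroDensity
import Literature.GroupTheory.FiniteAbelian.IndependentGenerators
import HarnessLib

/-!
# Route `CMKolyvaginAtInertTwo`, crux `CMKolyvaginExactAtInertTwo` (stmt-BirchSwinnertonDyer-24277):
# THE ČEBOTAREV LEAF AT `p = 2`, LEVEL `2^M`, FOR DEPENDENT FAMILIES — prescribed values of a
# HOMOMORPHISM on the span (McCallum's (2) for an arbitrary finite `C ⊂ H¹(K, E[2^M])`)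

Seat `bsd-line-cmk2-p1` g12 (cell `bsd-print-cf2`); helper (`--supports stmt-BirchSwinnertonDyer-24277`).
THEOREMS ONLY: no definition, no named fact, no `sorry`; no item is closed; BSD is not proved by this.
Companion memo: `Cruxes/CMExactDescentAtTwo/MEMO-T5-adaptive-splitting.md` §1.3, §3.5 (kernel task K3).

WHY. Seat g7's leaf `exists_kolyvaginPrime_gt_two_pow_of_targets` aims a depth-`M` Kolyvagin prime at
ARBITRARY targets `t_i` for an INDEPENDENT family `x_i` (hypothesis `hind`). In the adaptive run of
McCallum's Thm. 5.4 at `2` (memo §3) the step family `{c(n_k), c_{k+1}} ∪ {later lifts}` is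
typically DEPENDENT in `H¹(K, E[2^M])` (memo 3.5: `bottom c(n_k) ≡ bottom c_{k+1}` modulo the later
bottoms), so the prescription must be phrased for a HOMOMORPHISM `ψ` on the span `C = ⟨x_i⟩`:
McCallum's (2), *"`Gal(L_C/L) ≃ Hom(C, E_{p^M})`"* for "any finite subgroup `C`" (PDF p. 279).

* `exists_kolyvaginPrime_gt_two_pow_of_hom` — same frame as g7's leaf (`W/ℚ`, `ρ̄_{W,2}` onto, `K`
  imaginary quadratic with `Δ_W ∉ K²`, `c ≠ 1`, a complex conjugation `c₀`, `M ≥ 1`, the Cartan-type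
  element `z` with `hcomm`), a finite family `x_i ∈ H¹(K, E[2^M])` closed under `σ_*` up to sign and
  permutation (`σ_* x_i = ν_i x_{ι i}`) — NO independence —, and an additive `ψ : ⟨x_i⟩ → E[2^M]`.
  THEN for every `b` there are a prime `ℓ > b` (`ℓ ∤ 2 N d_K`, `(ℓ)` prime in `𝓞_K`,
  `Frob(ℓ) = Frob(∞)` on `K(E[2^M])`) and `F ∈ Γ_{K(E[2^M])}` (a Frobenius of `λ = (ℓ)`) with
  **`[x_i, F] = ν_i · τ ψ(x_{ι i}) + ψ(x_i)`** and McCallum's (3) `x_λ = 0 ⟺ [x, F] = 0` on the span.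
  PROOF. The span `C` is finite (finitely generated, killed by `2^M`); take independent generators
  `g_j` of the abstract group `C` (tree `FiniteAbelian.exists_indep_generators`), apply g7's
  `exists_h1Eval_eq_two_pow` to `(g_j)` with targets `ψ(g_j)`: `[·, ρ] = ψ` on `C` by additivity;
  then the tree's `exists_kolyvaginPrime_gt_of_galoisElement` (any family) and the value at
  `F = (ρm)^τ(ρm)` exactly as in g7's leaf (`IsLiftOfAut.h1Eval_conjAct`, `m ∈ evalKer`).

References: [McCallumLMS1991] §3 (2), (3), Prop. 3.1, Cor. 3.2 (PDF pp. 279–280);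
[GrossLMS1991] §9 Props. 9.1, 9.3.
-/

-- single-conjunct summit: `Summit.BirchSwinnertonDyer.BirchSwinnertonDyer.…` repeats the name by design
set_option linter.dupNamespace false
set_option autoImplicit false

noncomputable section

open scoped Classical Pointwise
open WeierstrassCurve NumberField IsDedekindDomain Field
open Literature.NumberTheory.GaloisRepresentations Literature.NumberTheory.EllipticCurves

namespace Summit.BirchSwinnertonDyer.BirchSwinnertonDyer.Theorems.KolyvaginImageTwo

/-- **McCallum's (2) + Prop. 3.1 at `p = 2`, level `2^M`, for a possibly DEPENDENT eigen-family:
prescribed values of a homomorphism on the span.** See the module docstring. Hypotheses as in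
`exists_kolyvaginPrime_gt_two_pow_of_targets` without independence; `ψ` an additive map on the span
of the `x_i` into `E[2^M]`. Conclusion: `ℓ > b`, `ℓ ∤ N`, `ℓ ∤ d_K`, `ℓ ≠ 2`, `(ℓ)` prime,
`FrobEqFrobInfty W K (2^M) ℓ`, and `F ∈ Γ_{K(E[2^M])}` with `[x_i, F] = ν_i τ ψ(x_{ι i}) + ψ(x_i)` and
`x_λ = 0 ⟺ [x, F] = 0` on the span. [cite: McCallumLMS1991, §3 (2), (3), Prop. 3.1, Cor. 3.2 (proofs)]
[cite: GrossLMS1991, §9 (Props. 9.3, 9.6 and the density argument)] -/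
theorem exists_kolyvaginPrime_gt_two_pow_of_hom
    (hC : Literature.NumberTheory.Automorphic.chebotarev_artinRep)
    {N : ℕ} [NeZero N] (W : WeierstrassCurve ℚ) [W.IsElliptic] {K : Type} [Field K] [NumberField K]
    (hK : IsImaginaryQuadratic K) (hρ : W.HasSurjectiveModNGaloisRep 2)
    (hΔK : ¬ IsSquare (W.baseChange K).Δ) {c : K ≃ₐ[ℚ] K} (hc : c ≠ 1)
    {c₀ : absoluteGaloisGroup ℚ} (hc₀ : IsComplexConjugation (Rat.castHom ℝ) c₀)
    {M : ℕ} (hM : 1 ≤ M) {z : absoluteGaloisGroup K}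
    (hzfix : ∀ P : geomTorsion (W.baseChange K) ((2 : ℕ) : ℤ), z • P = P → P = 0)
    (hcomm : ∀ π ∈ torsionFixing (W.baseChange K) ((2 : ℕ) : ℤ),
      ∀ P : geomTorsion (W.baseChange K) ((2 ^ M : ℕ) : ℤ), π • z • P = z • π • P)
    {r : ℕ} (cs : Fin r → galH1Torsion (W.baseChange K) ((2 ^ M : ℕ) : ℤ))
    (ι : Fin r → Fin r) (ν : Fin r → ℤ)
    (hτ : ∀ i, conjAct W c ((2 ^ M : ℕ) : ℤ) (cs i) = ν i • cs (ι i))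
    (ψ : AddSubgroup.closure (Set.range cs) →+ geomTorsion (W.baseChange K) ((2 ^ M : ℕ) : ℤ))
    (b : ℕ) :
    ∃ ℓ : ℕ, b < ℓ ∧ ℓ.Prime ∧ ¬ ℓ ∣ N ∧ ¬ ((ℓ : ℤ) ∣ NumberField.discr K) ∧ ℓ ≠ 2 ∧
      (Ideal.span {(ℓ : 𝓞 K)}).IsPrime ∧ FrobEqFrobInfty W K (2 ^ M) ℓ ∧
      ∃ F ∈ torsionFixing (W.baseChange K) ((2 ^ M : ℕ) : ℤ),
        (∀ i, h1Eval (W.baseChange K) ((2 ^ M : ℕ) : ℤ) (cs i) F =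
          ν i • (RatClosure.isLiftOfAut_absGaloisTransport_of_isImaginaryQuadratic hK hc hc₀).torsionMap
              W ((2 ^ M : ℕ) : ℤ) (ψ ⟨cs (ι i), AddSubgroup.subset_closure ⟨ι i, rfl⟩⟩) +
            ψ ⟨cs i, AddSubgroup.subset_closure ⟨i, rfl⟩⟩) ∧
        ∀ x ∈ AddSubgroup.closure (Set.range cs),
          ∀ v : HeightOneSpectrum (𝓞 K), (ℓ : 𝓞 K) ∈ v.asIdeal →
            (x ∈ (W.baseChange K).torsionLocalKer (v.adicCompletion K) ((2 ^ M : ℕ) : ℤ) ↔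
              h1Eval (W.baseChange K) ((2 ^ M : ℕ) : ℤ) x F = 0) := by
  classical
  haveI : Algebra.IsQuadraticExtension ℚ K := ⟨hK.1⟩
  haveI : IsTotallyComplex K := hK.2
  -- ### Step A: the involutive lift of `c` through the complex conjugation `c₀`
  have ht : IsLiftOfAut c (absGaloisTransport (K := ℚ) (L := K) c₀).toRingEquiv :=
    RatClosure.isLiftOfAut_absGaloisTransport_of_isImaginaryQuadratic hK hc hc₀
  have hinv : ∀ x, (absGaloisTransport (K := ℚ) (L := K) c₀).toRingEquiv
      ((absGaloisTransport (K := ℚ) (L := K) c₀).toRingEquiv x) = x := fun x ↦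
    RatClosure.absGaloisTransport_absGaloisTransport_of_sq_eq_one hc₀.sq_eq_one x
  -- ### the span `C` of the family is a finite abelian group
  haveI : AddGroup.FG (AddSubgroup.closure (Set.range cs)) := AddGroup.closure_finite_fg _
  have htor : AddMonoid.IsTorsion (AddSubgroup.closure (Set.range cs)) := fun x ↦ by
    rw [isOfFinAddOrder_iff_nsmul_eq_zero]
    refine ⟨2 ^ M, pow_pos two_pos M, Subtype.ext ?_⟩
    rw [AddSubgroupClass.coe_nsmul, ZeroMemClass.coe_zero, ← natCast_zsmul]
    exact zsmul_galH1Torsion_eq_zero (W.baseChange K) ((2 ^ M : ℕ) : ℤ) x.1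
  haveI : Finite (AddSubgroup.closure (Set.range cs)) :=
    AddCommGroup.finite_of_fg_torsion (AddSubgroup.closure (Set.range cs)) htor
  -- ### independent generators of `C` and their exponents
  obtain ⟨κ, _, g, hgind, hgspan⟩ :=
    Literature.GroupTheory.FiniteAbelian.exists_indep_generators (G := AddSubgroup.closure (Set.range cs))
  have hpow : ∀ j, ((2 ^ M : ℕ) : ℤ) • (g j : galH1Torsion (W.baseChange K) ((2 ^ M : ℕ) : ℤ)) = 0 :=
    fun j ↦ zsmul_galH1Torsion_eq_zero (W.baseChange K) _ _
  have hord : ∀ j, ∃ e : ℕ, addOrderOf (g j) = 2 ^ e := fun j ↦ by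
    have h1 : addOrderOf (g j) ∣ 2 ^ M := by
      apply addOrderOf_dvd_of_nsmul_eq_zero
      apply Subtype.ext
      rw [AddSubgroupClass.coe_nsmul, ZeroMemClass.coe_zero, ← natCast_zsmul]
      exact hpow j
    obtain ⟨e, -, he⟩ := (Nat.dvd_prime_pow Nat.prime_two).1 h1
    exact ⟨e, he⟩
  choose e he using hord
  have hcast : ∀ j, (((2 : ℕ) : ℤ) ^ e j) = ((addOrderOf (g j) : ℕ) : ℤ) := fun j ↦ by
    rw [he j, Nat.cast_pow]
  -- ### Step B for the independent family `(g_j)` with targets `ψ(g_j)`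
  obtain ⟨ρ, hρT, hρe⟩ := exists_h1Eval_eq_two_pow W K hK.1 hρ hΔK hM hzfix hcomm
    (fun j ↦ (g j : galH1Torsion (W.baseChange K) ((2 ^ M : ℕ) : ℤ))) e
    (fun j ↦ by
      rw [hcast, natCast_zsmul, ← AddSubgroupClass.coe_nsmul, addOrderOf_nsmul_eq_zero,
        ZeroMemClass.coe_zero])
    (fun a ha j ↦ by
      rw [hcast]
      refine hgind a (Subtype.ext ?_) j
      rw [AddSubgroup.val_finsetSum, ZeroMemClass.coe_zero, ← ha]
      exact Finset.sum_congr rfl fun i _ ↦ by rw [AddSubgroupClass.coe_zsmul])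
    (fun j ↦ ψ (g j))
    (fun j ↦ by
      rw [hcast, natCast_zsmul, ← map_nsmul, addOrderOf_nsmul_eq_zero, map_zero])
  -- `[x, ρ] = ψ x` on the span
  have hρψ : ∀ x : AddSubgroup.closure (Set.range cs),
      h1Eval (W.baseChange K) ((2 ^ M : ℕ) : ℤ) (x : galH1Torsion _ _) ρ = ψ x := by
    intro x
    obtain ⟨a, rfl⟩ := hgspan x
    rw [AddSubgroup.val_finsetSum, map_sum]
    simp only [AddSubgroupClass.coe_zsmul, map_zsmul]
    rw [h1Eval_sum (W.baseChange K) _ _ _ hρT]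
    refine Finset.sum_congr rfl fun j _ ↦ ?_
    rw [h1Eval_zsmul (W.baseChange K) _ _ _ hρT, hρe j]
  have hρψ' : ∀ i, h1Eval (W.baseChange K) ((2 ^ M : ℕ) : ℤ) (cs i) ρ =
      ψ ⟨cs i, AddSubgroup.subset_closure ⟨i, rfl⟩⟩ := fun i ↦
    hρψ ⟨cs i, AddSubgroup.subset_closure ⟨i, rfl⟩⟩
  -- ### Steps C–G: the tree's level-general Čebotarev bookkeeping, ORIGINAL family
  obtain ⟨ℓ, hbℓ, hℓ, hℓN, hℓD, hℓ2, hprime, hfrob, m, hm, hloc⟩ :=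
    exists_kolyvaginPrime_gt_of_galoisElement hC (N := N) (W := W) hK Nat.prime_two (M := M) hc₀ ht
      hinv cs hρT b
  have hρm : ρ * m ∈ torsionFixing (W.baseChange K) ((2 ^ M : ℕ) : ℤ) := mul_mem hρT hm.1
  have hρm' := ht.conjGalCMH_mem_torsionFixing W hinv _ hρm
  refine ⟨ℓ, hbℓ, hℓ, hℓN, hℓD, hℓ2, hprime, hfrob, ht.conjGalCMH (ρ * m) * (ρ * m),
    mul_mem hρm' hρm, fun i ↦ ?_, hloc⟩
  -- ### the value at `F = (ρm)^τ (ρm)`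
  have hconj : h1Eval (W.baseChange K) ((2 ^ M : ℕ) : ℤ) (cs i) (ht.conjGalCMH (ρ * m)) =
      ν i • ht.torsionMap W ((2 ^ M : ℕ) : ℤ) (ψ ⟨cs (ι i), AddSubgroup.subset_closure ⟨ι i, rfl⟩⟩) := by
    have h := ht.h1Eval_conjAct W ((2 ^ M : ℕ) : ℤ) (cs i) hρm
    rw [hτ i, h1Eval_zsmul _ _ _ _ hρm, h1Eval_mul _ _ _ hρT, hρψ' (ι i), hm.2 (ι i), add_zero] at h
    have h' := congrArg (ht.torsionMap W ((2 ^ M : ℕ) : ℤ)) h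
    rw [ht.torsionMap_torsionMap W hinv, map_zsmul] at h'
    exact h'.symm
  rw [h1Eval_mul _ _ _ hρm', hconj, h1Eval_mul _ _ _ hρT, hρψ' i, hm.2 i, add_zero]

end Summit.BirchSwinnertonDyer.BirchSwinnertonDyer.Theorems.KolyvaginImageTwo

end
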